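import Literature.NumberTheory.EllipticCurves.J0MulOmega
import Literature.AlgebraicGeometry.HodgeTheory.AbelianVarietyEllipticCurveHomDegreeQuadraticForm
import Literature.AlgebraicGeometry.HodgeTheory.AbelianVarietyEllipticCurveAutomorphismGroup
import HarnessLib

/-!
# `deg(m + n[ω]) = m² − mn + n²` on `y² + y = x³` over `ℂ`, and the necessity of `End(A) ≈ ℤ` in Lang's Propositions 2 and 3 at `j = 0`: three automorphisms pairwise not `±` each other, and distinct kernels of order `7` with isomorphic quotients

Layer `Literature/AlgebraicGeometry/HodgeTheory`, namespace `Literature.AlgebraicGeometry.HodgeTheory`; the theorems are declared in the namespace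
`Literature.NumberTheory.EllipticCurves.J0` of the tree's model of `E′ : y² + y = x³` (`j = 0`; `NumberTheory/EllipticCurves/J0MulOmega`: the abelian
variety `J0.abelianVariety K` for `3 ∈ Kˣ`, `dim = 1`, the endomorphism `J0.mulOmega hω : E′ ⟶ E′`, `[ω] : (x, y) ↦ (ωx, y)` for `ω² + ω + 1 = 0`, with
`mulOmega_comp_mulOmega_add : [ω] ≫ [ω] + [ω] + 𝟙 = 0`, `mulOmega_comp_mulOmega_comp_mulOmega : [ω]³ = 𝟙`, `mulOmega_ne_id`).  THEOREMS ONLY (no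
definition, no named fact, no instance, no notation; D-0026 net debt 0).  Companion of `J1728GaussianEndomorphismDegrees` (`j = 1728`, `ℤ[i]`); here
`K = ℂ` and `ω` is any root of `X² + X + 1` in `ℂ`.  Degrees `d(φ) = |Ker φ(ℂ)| = Nat.card (Hom.kerPoints (specOver ℂ ℂ) φ)`, traces `t(φ) = tr(φ^* |
H¹(E′(ℂ); ℤ))`, and the degree form `deg(m·𝟙 + n·φ) = m² + mn·t(φ) + n²·deg φ` (`det_singularCohomology_map_zsmul_id_add_zsmul_one_of_dim_eq_one`) at
`φ = [ω]` (`t([ω]) = −1`, `deg [ω] = 1`).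

THE PRINTS.  J. H. Silverman, *The Arithmetic of Elliptic Curves* [SilvermanAEC2009] III §10 Thm. 10.1 («`j(E) = 0` … `Aut(E)` cyclic of order `6`») and
App. C §11 Example 11.3.1 (the `j = 0` row of the CM table, `End = ℤ[ω]`); R. Hartshorne, *Algebraic Geometry* [Hartshorne1977] IV Example 4.20.2 (the
automorphism of order `3` of `y² = x³ − 1`… `j = 0`).  J. H. Silverman, *Advanced Topics* [Silverman1994] II §1 Cor. 1.5 (held book p0108 L18): «`deg[α] =
… = |N^K_ℚ α|`» — for `ℤ[ω]`: `N(m + nω) = m² − mn + n²`.  S. Lang, *Elliptic Functions* [Lang1987] Ch. 2 §2 Props. 2, 3 (p. 23) under «`End(A) ≈ Z`»: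
here, without it, `𝟙, [ω], [ω]² = −𝟙 − [ω]` are three automorphisms of degree `1` pairwise not `±` each other, and `𝔤 = Ker(3 + [ω])`, `𝔤′ = Ker(2 −
[ω])` (the two primes of `ℤ[ω]` above `7 = (3 + ω)(3 + ω̄)`, `3 + ω̄ = 2 − ω`) are DISTINCT subgroups of order `7` with `E′/𝔤 ≅ E′ ≅ E′/𝔤′`.

## What is proved (`E′ = J0.abelianVariety ℂ`, `[ω] = J0.mulOmega hω`, `hω : ω ^ 2 + ω + 1 = 0` in `ℂ`; `[Fact (IsUnit (3 : ℂ))]` as in the model file)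

* §1 `[ω]` ON `H¹`: `mulOmega_comp_mulOmega_sq`, `mulOmega_sq_comp_mulOmega` (`[ω]` is a unit with inverse `[ω]²`, every `K`), `mulOmega_comp_mulOmega_eq`
  (`[ω]² = −[ω] − 𝟙`, every `K`), `det_mulOmega` (`= 1`), **`trace_mulOmega`** (`t([ω]) = −1`), **`natCard_kerPoints_mulOmega`** (`deg [ω] = 1`),
  **`mulOmega_ne_zsmul_id`** (`[ω] ∉ ℤ·𝟙`, by parity of the trace), `exists_forall_ne_intCast` (`End(E′) ≠ ℤ`), `mulOmega_ne_neg_id`.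
* §2 THE EISENSTEIN NORM: **`natCard_kerPoints_zsmul_id_add_zsmul_mulOmega`** (`deg(m·𝟙 + n·[ω]) = m² − mn + n²`), `natCard_kerPoints_zsmul_id_sub_zsmul_mulOmega`
  (`deg(m·𝟙 − n·[ω]) = m² + mn + n²`), `natCard_kerPoints_three_zsmul_id_add_mulOmega`, `natCard_kerPoints_two_zsmul_id_sub_mulOmega` (both `= 7`).
* §3 LANG PROP. 2 NEEDS `End = ℤ` (`j = 0`): `natCard_kerPoints_neg_id_sub_mulOmega` (`deg(−𝟙 − [ω]) = 1`), `neg_id_sub_mulOmega_ne_mulOmega`,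
  `neg_id_sub_mulOmega_ne_neg_mulOmega`, **`exists_three_natCard_kerPoints_eq_one_pairwise_ne`** (`𝟙, [ω], −𝟙 − [ω]`: degree `1`, pairwise neither equal
  nor opposite).
* §4 LANG PROP. 3 NEEDS `End = ℤ` (`j = 0`): `kerPoints_le_kerPoints_five_zsmul_id_of_eq`, **`kerPoints_three_zsmul_id_add_mulOmega_ne`** (`Ker(3 + [ω])(ℂ) ≠
  Ker(2 − [ω])(ℂ)`, both of order `7`: `7 ∤ 25 = #E′[5](ℂ)`), **`exists_isIsogeny_natCard_kerPoints_eq_seven_and_kerPoints_ne`**.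

## SCOPE

Only `y² + y = x³` over `ℂ` with its `[ω]` from the tree; `End(E′) = ℤ[ω]` exactly is not claimed (the tree's CM files).  Nothing here is a case of the
Hodge conjecture.

## References

* [SilvermanAEC2009] J. H. Silverman, *The Arithmetic of Elliptic Curves*, 2nd ed., GTM 106, Springer 2009 — III §10 Thm. 10.1; III §6 Thm. 6.2 (d), Cor. 6.4 (a);
  App. C §11 Example 11.3.1.
* [Silverman1994] J. H. Silverman, *Advanced Topics in the Arithmetic of Elliptic Curves*, GTM 151, Springer 1994 — II §1 Cor. 1.5.
* [Hartshorne1977] R. Hartshorne, *Algebraic Geometry*, GTM 52, Springer 1977 — IV Example 4.20.2.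
* [Lang1987] S. Lang, *Elliptic Functions*, 2nd ed., GTM 112, Springer 1987 — Ch. 2 §2 Propositions 2, 3 (p. 23).

## Provenance

lit-hodgefound prover seat p21, generation 47, row g47-#9 (own row, claimed by path; companion of g47-#8, complement of g47-#5).
-/

open Function CategoryTheory Module
open Literature.AlgebraicTopology.SingularHomology

namespace Literature.NumberTheory.EllipticCurves.J0

open _root_.AlgebraicGeometry
open Literature.AlgebraicGeometry.Motives
open Literature.AlgebraicGeometry.Motives.AbelianVariety
open Literature.AlgebraicGeometry.HodgeTheory.AbelianVariety
open scoped MonObj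

universe u

/-! ### §1 `[ω]` on `H¹(E′(ℂ); ℤ)` -/

section AnyField

variable {K : Type u} [Field K] [Fact (IsUnit (3 : K))] {ω : K} (hω : ω ^ 2 + ω + 1 = 0)

/-- `[ω] ≫ [ω]² = 𝟙`: `[ω]` is an automorphism with inverse `[ω]²`. [cite: SilvermanAEC2009, III §10 Thm. 10.1] [cite: Hartshorne1977, IV Example 4.20.2] -/
theorem mulOmega_comp_mulOmega_sq : mulOmega hω ≫ (mulOmega hω ≫ mulOmega hω) = 𝟙 (abelianVariety K) := by
  rw [← Category.assoc]
  exact mulOmega_comp_mulOmega_comp_mulOmega hω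

/-- `[ω]² ≫ [ω] = 𝟙`. [cite: SilvermanAEC2009, III §10 Thm. 10.1] [cite: Hartshorne1977, IV Example 4.20.2] -/
theorem mulOmega_sq_comp_mulOmega : (mulOmega hω ≫ mulOmega hω) ≫ mulOmega hω = 𝟙 (abelianVariety K) :=
  mulOmega_comp_mulOmega_comp_mulOmega hω

/-- `[ω] ≫ [ω] = −[ω] − 𝟙` (`[ω]² + [ω] + 1 = 0`). [cite: SilvermanAEC2009, App. C §11 Example 11.3.1] -/
theorem mulOmega_comp_mulOmega_eq : mulOmega hω ≫ mulOmega hω = -mulOmega hω - 𝟙 (abelianVariety K) := by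
  have h := mulOmega_comp_mulOmega_add hω
  rw [add_assoc, add_eq_zero_iff_eq_neg, neg_add'] at h
  exact h

end AnyField

section Complex

variable [Fact (IsUnit (3 : ℂ))] {ω : ℂ} (hω : ω ^ 2 + ω + 1 = 0)
include hω

/-- `det([ω]^* | H¹(E′(ℂ); ℤ)) = 1`. [cite: SilvermanAEC2009, III §10 Thm. 10.1] -/
theorem det_mulOmega :
    LinearMap.det (singularCohomology.map ℤ ℤ (AlgPoints.mapContinuous (L := ℂ) (mulOmega hω).hom.hom.hom) 1).hom = 1 :=
  det_singularCohomology_map_one_eq_one_of_comp_eq_id (mulOmega_comp_mulOmega_sq hω)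

/-- **`t([ω]) = tr([ω]^* | H¹(E′(ℂ); ℤ)) = −1`** (`[ω] ≫ [ω] = (−1)·[ω] − 𝟙`). [cite: SilvermanAEC2009, III §10 Thm. 10.1 and App. C §11 Example 11.3.1] -/
theorem trace_mulOmega :
    LinearMap.trace ℤ _ (singularCohomology.map ℤ ℤ (AlgPoints.mapContinuous (L := ℂ) (mulOmega hω).hom.hom.hom) 1).hom = -1 :=
  trace_eq_of_comp_self_eq_zsmul_sub_id (dim_abelianVariety ℂ) (mulOmega_comp_mulOmega_sq hω) (-1)
    (by rw [neg_one_zsmul]; exact mulOmega_comp_mulOmega_eq hω)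

/-- **`deg [ω] = 1`.** [cite: SilvermanAEC2009, III §10 Thm. 10.1] [cite: Silverman1994, II §1 Cor. 1.5] -/
theorem natCard_kerPoints_mulOmega : Nat.card (Hom.kerPoints (specOver ℂ ℂ) (mulOmega hω)) = 1 := by
  have h := natCard_kerPoints_eq_det_singularCohomology_map_one (mulOmega hω)
  rw [det_mulOmega hω] at h
  exact_mod_cast h

/-- **`[ω] ∉ ℤ·𝟙`**: `[ω] ≠ m·𝟙` for every integer `m` (`t([ω]) = −1` is odd, `t(m·𝟙) = 2m`). [cite: SilvermanAEC2009, App. C §11 Example 11.3.1 and III §9] -/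
theorem mulOmega_ne_zsmul_id (m : ℤ) : mulOmega hω ≠ m • 𝟙 (abelianVariety ℂ) := by
  intro h
  have ht := (trace_eq_two_mul_and_det_eq_sq_of_eq_zsmul_id (dim_abelianVariety ℂ) _ m h).1
  rw [trace_mulOmega hω] at ht
  omega

/-- **`End(E′) ≠ ℤ` for `E′ : y² + y = x³` over `ℂ`**, in the tree's hypothesis form («`End(A) ≈ Z`» fails at `[ω]`).
[cite: SilvermanAEC2009, App. C §11 Example 11.3.1 and III §9] -/
theorem exists_forall_ne_intCast : ∃ f : End (abelianVariety ℂ), ∀ m : ℤ, f ≠ m := by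
  refine ⟨mulOmega hω, fun m hm => mulOmega_ne_zsmul_id hω m (hm.trans ?_)⟩
  rw [← zsmul_one m]
  rfl

/-- `[ω] ≠ −𝟙`. [cite: SilvermanAEC2009, III §10 Thm. 10.1] -/
theorem mulOmega_ne_neg_id : mulOmega hω ≠ -𝟙 (abelianVariety ℂ) := by
  intro h
  exact mulOmega_ne_zsmul_id hω (-1) (by rw [h, neg_one_zsmul])

/-! ### §2 The Eisenstein norm `deg(m + n[ω]) = m² − mn + n²` -/

/-- **`deg(m·𝟙 + n·[ω]) = m² − mn + n²`** on `E′ : y² + y = x³` over `ℂ` — the norm form of `ℤ[ω]` («`deg[α] = |N^K_ℚ α|`»; from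
`deg(m·𝟙 + n·φ) = m² + mn·t(φ) + n²·deg φ` with `t([ω]) = −1`, `deg [ω] = 1`). [cite: Silverman1994, II §1 Cor. 1.5] [cite: SilvermanAEC2009, App. C §11 Example 11.3.1
and III §6 Thm. 6.2 (d)] -/
theorem natCard_kerPoints_zsmul_id_add_zsmul_mulOmega (m n : ℤ) :
    (Nat.card (Hom.kerPoints (specOver ℂ ℂ) (m • 𝟙 (abelianVariety ℂ) + n • mulOmega hω)) : ℤ) = m ^ 2 - m * n + n ^ 2 := by
  rw [natCard_kerPoints_eq_det_singularCohomology_map_one,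
    det_singularCohomology_map_zsmul_id_add_zsmul_one_of_dim_eq_one (dim_abelianVariety ℂ) m n, trace_mulOmega hω, det_mulOmega hω]
  ring

/-- `deg(m·𝟙 − n·[ω]) = m² + mn + n²` (`N(m − nω) = N(m + nω̄ + n) …`; the form at `−[ω]`, of trace `1`). [cite: Silverman1994, II §1 Cor. 1.5]
[cite: SilvermanAEC2009, App. C §11 Example 11.3.1] -/
theorem natCard_kerPoints_zsmul_id_sub_zsmul_mulOmega (m n : ℤ) :
    (Nat.card (Hom.kerPoints (specOver ℂ ℂ) (m • 𝟙 (abelianVariety ℂ) - n • mulOmega hω)) : ℤ) = m ^ 2 + m * n + n ^ 2 := by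
  rw [sub_eq_add_neg, ← neg_zsmul, natCard_kerPoints_zsmul_id_add_zsmul_mulOmega hω]
  ring

/-- `deg(3 + [ω]) = 7`. [cite: Silverman1994, II §1 Cor. 1.5] -/
theorem natCard_kerPoints_three_zsmul_id_add_mulOmega :
    Nat.card (Hom.kerPoints (specOver ℂ ℂ) ((3 : ℤ) • 𝟙 (abelianVariety ℂ) + mulOmega hω)) = 7 := by
  have h := natCard_kerPoints_zsmul_id_add_zsmul_mulOmega hω 3 1
  rw [one_zsmul] at h
  norm_num at h
  exact_mod_cast h

/-- `deg(2 − [ω]) = 7` (`2 − ω = 3 + ω̄`, the conjugate prime above `7`). [cite: Silverman1994, II §1 Cor. 1.5] -/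
theorem natCard_kerPoints_two_zsmul_id_sub_mulOmega :
    Nat.card (Hom.kerPoints (specOver ℂ ℂ) ((2 : ℤ) • 𝟙 (abelianVariety ℂ) - mulOmega hω)) = 7 := by
  have h := natCard_kerPoints_zsmul_id_sub_zsmul_mulOmega hω 2 1
  rw [one_zsmul] at h
  exact_mod_cast h

/-! ### §3 Lang's Proposition 2 needs `End(A) ≈ ℤ` (the case `j = 0`) -/

/-- `deg(−𝟙 − [ω]) = 1` (`−𝟙 − [ω] = [ω]²` is an automorphism). [cite: SilvermanAEC2009, III §10 Thm. 10.1] [cite: Silverman1994, II §1 Cor. 1.5] -/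
theorem natCard_kerPoints_neg_id_sub_mulOmega :
    Nat.card (Hom.kerPoints (specOver ℂ ℂ) (-𝟙 (abelianVariety ℂ) - mulOmega hω)) = 1 := by
  rw [show -𝟙 (abelianVariety ℂ) - mulOmega hω = mulOmega hω ≫ mulOmega hω by rw [mulOmega_comp_mulOmega_eq]; abel,
    natCard_kerPoints_comp_of_dim_eq_one (dim_abelianVariety ℂ) (dim_abelianVariety ℂ), natCard_kerPoints_mulOmega hω]

/-- `−𝟙 − [ω] ≠ [ω]` (`2·[ω] = −𝟙` would give `deg 4 = deg 1`). [cite: SilvermanAEC2009, III §10 Thm. 10.1] -/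
theorem neg_id_sub_mulOmega_ne_mulOmega : -𝟙 (abelianVariety ℂ) - mulOmega hω ≠ mulOmega hω := by
  intro h
  have h2 : (2 : ℤ) • mulOmega hω = -𝟙 (abelianVariety ℂ) := by
    rw [two_zsmul]
    nth_rw 1 [← h]
    abel
  have hd := natCard_kerPoints_zsmul_of_dim_eq_one (dim_abelianVariety ℂ) (dim_abelianVariety ℂ) 2 (mulOmega hω)
  rw [h2, natCard_kerPoints_neg, Hom.kerPoints_id, Subgroup.card_bot, natCard_kerPoints_mulOmega hω] at hd
  norm_num at hd

/-- `−𝟙 − [ω] ≠ −[ω]` (`𝟙 ≠ 0`). [cite: SilvermanAEC2009, III §10 Thm. 10.1] -/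
theorem neg_id_sub_mulOmega_ne_neg_mulOmega : -𝟙 (abelianVariety ℂ) - mulOmega hω ≠ -mulOmega hω := by
  intro h
  have h1 : (𝟙 (abelianVariety ℂ)) = 0 := by
    rw [← neg_eq_zero]
    have := congrArg (· + mulOmega hω) h
    simpa using this
  have hd := natCard_kerPoints_zero_eq_zero (A := abelianVariety ℂ) (B := abelianVariety ℂ) (by rw [dim_abelianVariety]; norm_num)
  rw [← h1, Hom.kerPoints_id, Subgroup.card_bot] at hd
  exact one_ne_zero hd

/-- **WITHOUT `End(A) ≈ ℤ` (here `j = 0`), THREE homomorphisms of the same degree, pairwise neither equal nor opposite**: `𝟙`, `[ω]`, `−𝟙 − [ω] = [ω]²`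
all have degree `1` (contrast Lang's Prop. 2 «only one other isomorphism … `−λ`» under `End(A) ≈ Z`; `Aut(E′) ≅ μ₆`). [cite: Lang1987, Ch. 2 §2 Prop. 2 (p. 23)]
[cite: SilvermanAEC2009, III §10 Thm. 10.1 (`j = 0`: order `6`)] -/
theorem exists_three_natCard_kerPoints_eq_one_pairwise_ne :
    ∃ φ ψ χ : abelianVariety ℂ ⟶ abelianVariety ℂ,
      Nat.card (Hom.kerPoints (specOver ℂ ℂ) φ) = 1 ∧ Nat.card (Hom.kerPoints (specOver ℂ ℂ) ψ) = 1 ∧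
        Nat.card (Hom.kerPoints (specOver ℂ ℂ) χ) = 1 ∧
          ψ ≠ φ ∧ ψ ≠ -φ ∧ χ ≠ φ ∧ χ ≠ -φ ∧ χ ≠ ψ ∧ χ ≠ -ψ := by
  refine ⟨𝟙 _, mulOmega hω, -𝟙 _ - mulOmega hω, by rw [Hom.kerPoints_id, Subgroup.card_bot], natCard_kerPoints_mulOmega hω,
    natCard_kerPoints_neg_id_sub_mulOmega hω, ?_, mulOmega_ne_neg_id hω, ?_, ?_, neg_id_sub_mulOmega_ne_mulOmega hω,
    neg_id_sub_mulOmega_ne_neg_mulOmega hω⟩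
  · intro h
    exact mulOmega_ne_zsmul_id hω 1 (by rw [h, one_zsmul])
  · intro h
    refine mulOmega_ne_zsmul_id hω (-2) ?_
    have := congrArg (fun x => -x - 𝟙 (abelianVariety ℂ)) h
    simp only [neg_sub, sub_neg_eq_add] at this
    rw [show -𝟙 (abelianVariety ℂ) - 𝟙 (abelianVariety ℂ) = (-2 : ℤ) • 𝟙 (abelianVariety ℂ) by
      rw [neg_smul, two_zsmul, neg_add']] at this
    rw [← this]
    abel
  · intro h
    refine mulOmega_ne_zsmul_id hω 0 ?_
    have := congrArg (fun x => -x - 𝟙 (abelianVariety ℂ)) h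
    simp only [neg_sub, sub_neg_eq_add, neg_neg] at this
    rw [zero_zsmul, ← sub_self (𝟙 (abelianVariety ℂ))]
    rw [← this]
    abel

/-! ### §4 Lang's Proposition 3 needs `End(A) ≈ ℤ` (the case `j = 0`) -/

omit [Fact (IsUnit (3 : ℂ))] hω in
/-- Plumbing: `t ≫ (u + v) = (t ≫ u)·(t ≫ v)` on `T`-points. [folklore] -/
private theorem comp_hom_add' {A : AbelianVariety ℂ} {T : SchemeOver ℂ} (t : T ⟶ A.X) (u v : A ⟶ A) :
    t ≫ (u + v).hom.hom.hom = (t ≫ u.hom.hom.hom) * (t ≫ v.hom.hom.hom) :=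
  MonObj.comp_mul _ _ _

/-- If `Ker(3 + [ω])(ℂ) = Ker(2 − [ω])(ℂ)` then this common kernel lies in `E′[5](ℂ)` (`(3 + [ω]) + (2 − [ω]) = 5`). [cite: Lang1987, Ch. 2 §2 Prop. 3 (p. 23)]
[cite: SilvermanAEC2009, App. C §11 Example 11.3.1] -/
theorem kerPoints_le_kerPoints_five_zsmul_id_of_eq
    (h : Hom.kerPoints (specOver ℂ ℂ) ((3 : ℤ) • 𝟙 (abelianVariety ℂ) + mulOmega hω) =
      Hom.kerPoints (specOver ℂ ℂ) ((2 : ℤ) • 𝟙 (abelianVariety ℂ) - mulOmega hω)) :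
    Hom.kerPoints (specOver ℂ ℂ) ((3 : ℤ) • 𝟙 (abelianVariety ℂ) + mulOmega hω) ≤
      Hom.kerPoints (specOver ℂ ℂ) (((5 : ℕ) : ℤ) • 𝟙 (abelianVariety ℂ)) := by
  intro P hP
  have hP' : P ∈ Hom.kerPoints (specOver ℂ ℂ) ((2 : ℤ) • 𝟙 (abelianVariety ℂ) - mulOmega hω) := h ▸ hP
  rw [Hom.mem_kerPoints_iff] at hP hP' ⊢
  have e : ((5 : ℕ) : ℤ) • 𝟙 (abelianVariety ℂ) =
      ((3 : ℤ) • 𝟙 (abelianVariety ℂ) + mulOmega hω) + ((2 : ℤ) • 𝟙 (abelianVariety ℂ) - mulOmega hω) := by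
    rw [add_add_sub_cancel, ← add_zsmul]
    norm_num
  rw [e, comp_hom_add', hP, hP', one_mul]

/-- **WITHOUT `End(A) ≈ ℤ` (here `j = 0`), DISTINCT SUBGROUPS OF THE SAME ORDER WITH ISOMORPHIC QUOTIENTS**: `𝔤 = Ker(3 + [ω])(ℂ)` and
`𝔤′ = Ker(2 − [ω])(ℂ)` both have order `7` and `E′/𝔤 ≅ E′ ≅ E′/𝔤′`, yet `𝔤 ≠ 𝔤′` (equal kernels would lie in `E′[5](ℂ)`, of order `25`, and `7 ∤ 25`).
[cite: Lang1987, Ch. 2 §2 Prop. 3 (p. 23)] [cite: SilvermanAEC2009, App. C §11 Example 11.3.1 and III §6 Cor. 6.4 (a)] -/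
theorem kerPoints_three_zsmul_id_add_mulOmega_ne :
    Hom.kerPoints (specOver ℂ ℂ) ((3 : ℤ) • 𝟙 (abelianVariety ℂ) + mulOmega hω) ≠
      Hom.kerPoints (specOver ℂ ℂ) ((2 : ℤ) • 𝟙 (abelianVariety ℂ) - mulOmega hω) := by
  intro h
  have hle := kerPoints_le_kerPoints_five_zsmul_id_of_eq hω h
  have h25 : Nat.card (Hom.kerPoints (specOver ℂ ℂ) (((5 : ℕ) : ℤ) • 𝟙 (abelianVariety ℂ))) = 25 := by
    rw [natCard_kerPoints_zsmul_id (abelianVariety ℂ) 5 (by norm_num), dim_abelianVariety]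
    norm_num
  haveI : Finite (Hom.kerPoints (specOver ℂ ℂ) (((5 : ℕ) : ℤ) • 𝟙 (abelianVariety ℂ))) :=
    Nat.finite_of_card_ne_zero (by rw [h25]; norm_num)
  have hdvd := Subgroup.card_dvd_of_le hle
  rw [natCard_kerPoints_three_zsmul_id_add_mulOmega hω, h25] at hdvd
  revert hdvd
  decide

/-- **Prop. 3 FAILS WITHOUT `End(A) ≈ ℤ` at `j = 0`, as a statement about isogenies onto the same curve**: there are isogenies `α, α′ : E′ → E′` of the
same degree `7` with `Ker α(ℂ) ≠ Ker α′(ℂ)`. [cite: Lang1987, Ch. 2 §2 Prop. 3 (p. 23)] [cite: SilvermanAEC2009, App. C §11 Example 11.3.1] -/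
theorem exists_isIsogeny_natCard_kerPoints_eq_seven_and_kerPoints_ne :
    ∃ α α' : abelianVariety ℂ ⟶ abelianVariety ℂ, IsIsogeny α ∧ IsIsogeny α' ∧
      Nat.card (Hom.kerPoints (specOver ℂ ℂ) α) = 7 ∧ Nat.card (Hom.kerPoints (specOver ℂ ℂ) α') = 7 ∧
        Hom.kerPoints (specOver ℂ ℂ) α' ≠ Hom.kerPoints (specOver ℂ ℂ) α := by
  have hd := dim_abelianVariety ℂ
  refine ⟨(3 : ℤ) • 𝟙 _ + mulOmega hω, (2 : ℤ) • 𝟙 _ - mulOmega hω, ?_, ?_,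
    natCard_kerPoints_three_zsmul_id_add_mulOmega hω, natCard_kerPoints_two_zsmul_id_sub_mulOmega hω,
    fun h => kerPoints_three_zsmul_id_add_mulOmega_ne hω h.symm⟩
  · refine (isIsogeny_or_eq_zero_of_dim_eq_one hd hd _).resolve_right fun h0 => ?_
    have h := natCard_kerPoints_three_zsmul_id_add_mulOmega hω
    rw [h0, natCard_kerPoints_zero_eq_zero (by omega)] at h
    exact absurd h (by norm_num)
  · refine (isIsogeny_or_eq_zero_of_dim_eq_one hd hd _).resolve_right fun h0 => ?_
    have h := natCard_kerPoints_two_zsmul_id_sub_mulOmega hω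
    rw [h0, natCard_kerPoints_zero_eq_zero (by omega)] at h
    exact absurd h (by norm_num)

end Complex

end Literature.NumberTheory.EllipticCurves.J0
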